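import Mathlib.Analysis.SpecialFunctions.SmoothTransition
import Mathlib.Analysis.Calculus.BumpFunction.Basic
import Mathlib.Analysis.Calculus.BumpFunction.InnerProduct
import Mathlib.Analysis.Calculus.IteratedDeriv.Lemmas
import Mathlib.Analysis.Calculus.Deriv.MeanValue
import Mathlib.Analysis.SpecialFunctions.Pow.Real
import HarnessLib

/-!
# Steep energy-profile families with common value and slope at `t = 0`

Analysis/FluidPDE proof file, definition-free; sibling of `FractionalNSPrescribedEnergyProfiles`
(De Rosa's one-parameter profiles `c₀(1 - 2μT(1 - e^{-t/2T}))`, whose slopes at `0` DIFFER across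
the family). The proof of the non-uniqueness theorem for Leray solutions of the hypodissipative
Navier–Stokes system with `α < 1/5` (Colombo–De Lellis–De Rosa 2018, proof of Thm. 1.3, §2 p. 5)
feeds its Prop. 2.2 (`ColomboDeLellisDeRosa2018_prop22` of `FractionalNSPrescribedEnergyFamilies`)
with a family of profiles having, in addition, a COMMON slope `e'(0)` and a uniform `C²` bound:
"Elementary arguments produce for every `K > 1` an infinite set `𝓔_K` of smooth functions
`e : [0,1] → ℝ` with the following properties: (i) `½ ≤ e(t) ≤ 1`; (ii) `‖e‖_{C¹} ≤ 2K+2`;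
(iii) `e(0) = 1` and `e'(0) = -2K`; (iv) `e'(t) ≤ -2K+2` for `t ∈ [0, 1/4K]`; (v) `‖e‖_{C²} ≤ CK²`,
where `C` is a geometric constant independent of `K`; (vi) for any pair of distinct elements of
`𝓔_K` there is a sequence of times converging to `0` where they take different values."

* `exists_steepProfileSeq` — **these elementary arguments**, carried out in the level-`c₀`
  window used by the tree's transcriptions (`IsEnergyProfileFamily c₀ T₀ E₁ E₂`): absolute
  constants `A₁, A₂ ≥ 1` such that for every level `c₀ > 0` and frequency `Λ > 0` there is a
  sequence of smooth `e n : ℝ → ℝ` with `c₀/2 ≤ e n ≤ c₀` on `[0,∞)`, `e n 0 = c₀`,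
  `(e n)'(0) = -c₀Λ/4`, `|(e n)'| ≤ c₀ΛA₁`, `|(e n)''| ≤ c₀Λ²A₂`, `(e n)' ≤ -c₀Λ/8` on the window
  `[0, 1/(2Λ)]`, and pairwise different values at the time `1/(4Λ)` inside the window (which is
  what (vi) is used for). Construction: `e n s = c₀(F(Λs) + ηₙ φ(Λs))` with the smooth ramp
  `F(x) = 1 - x/4 - (2-x)·smoothTransition(x-1)/4` (`= 1 - x/4` for `x ≤ 1`, `≡ ½` for `x ≥ 2`;
  `exists_smooth_ramp`), a smooth bump `φ` supported in `(1/8, 3/8)` with `φ(1/4) = 1`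
  (`ContDiffBump`; `exists_smooth_bump`), and distinct amplitudes `ηₙ = η₀/(n+1)` with `η₀` so
  small that the bump spoils neither the window of values nor the slope bound on `[0, 1/(2Λ)]`.
  The `Λ`- and `Λ²`-scaling of the derivative bounds is the chain rule; the absolute constants
  are sup bounds of `F', F'', φ', φ''` (continuous, eventually constant / compactly supported).
* `sub_le_of_deriv_le_on_Icc` — the mean-value step "(iv) ⇒ `½(e(s) - e(t)) ≥ (K-1)(t-s)`".

Remark on (iii)–(v) as printed: with `e(0) = 1`, slope `≤ -2K+2` on the WHOLE of `[0, 1/4K]` and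
curvature `≤ CK²` with `C` independent of `K`, the profile reaches `≈ ½` at `t = 1/4K` with slope
still `≈ -2K`, and braking at curvature `CK²` costs a further drop `≈ 2/C`, so (i) fails for
large `K`; the window in (iv) has to be `c/K` with `c < 1/4` suitably small. This is immaterial
for Thm. 1.3, which asserts only SOME positive time `T` (here: slope `-c₀Λ/4`, window
`[0, 1/(2Λ)]`, drop `c₀/8` inside it, braking on `[1/Λ, 2/Λ]`).

## References

* M. Colombo, C. De Lellis, L. De Rosa, *Ill-posedness of Leray solutions for the hypodissipative
  Navier–Stokes equations*, Comm. Math. Phys. 362 (2018), 659–688 = arXiv:1708.05666, §2, proof of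
  Thm. 1.3 (p. 5), properties (i)–(vi). [`ColomboDelellisDerosa2018`]
* L. De Rosa, *Infinitely many Leray–Hopf solutions for the fractional Navier–Stokes equations*,
  Comm. PDE 44 (2019), 335–365 = arXiv:1801.10235, §2, proof of Thm. 1.2 (p. 5), (i)–(v).
  [`Derosa2018`]
-/

noncomputable section

open Set Filter Function
open scoped Topology ContDiff

namespace Literature.Analysis.FluidPDE

/-! ## A smooth ramp and a smooth bump -/

section Calculus

/-- If `f` agrees with `g` near `x`, their second derivatives at `x` agree. [folklore] -/
theorem deriv_deriv_eq_of_eventuallyEq {f g : ℝ → ℝ} {x : ℝ} (h : f =ᶠ[𝓝 x] g) :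
    deriv (deriv f) x = deriv (deriv g) x :=
  h.deriv.deriv_eq

/-- A smooth function on `ℝ` whose derivative takes the constant value `a` on `(-∞, 1)` and `b` on
`(2, ∞)` has a globally bounded derivative (bound it on the compact `[1,2]` by continuity).
[folklore] -/
theorem exists_forall_abs_le_of_eqOn {g : ℝ → ℝ} (hg : Continuous g) {a b : ℝ}
    (h₁ : ∀ x < 1, g x = a) (h₂ : ∀ x > 2, g x = b) : ∃ B : ℝ, 1 ≤ B ∧ ∀ x, |g x| ≤ B := by
  obtain ⟨C, hC⟩ := (isCompact_Icc (a := (1 : ℝ)) (b := 2)).exists_bound_of_continuousOn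
    hg.continuousOn
  refine ⟨max (max C 1) (max |a| |b|), le_max_of_le_left (le_max_right _ _), fun x => ?_⟩
  rcases lt_or_ge x 1 with hx | hx
  · rw [h₁ x hx]
    exact le_max_of_le_right (le_max_left _ _)
  rcases le_or_gt x 2 with hx' | hx'
  · have h := hC x ⟨hx, hx'⟩
    rw [Real.norm_eq_abs] at h
    exact le_max_of_le_left (h.trans (le_max_left _ _))
  · rw [h₂ x hx']
    exact le_max_of_le_right (le_max_right _ _)

/-- **The smooth ramp.** There is a smooth `F : ℝ → ℝ` with `F x = 1 - x/4` for `x ≤ 1`,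
`½ ≤ F ≤ 1` on `[0, ∞)`, and globally bounded first and second derivatives, the first being
`-1/4` and the second `0` on `(-∞, 1)`. (Take `F(x) = 1 - x/4 - (2-x)·smoothTransition(x-1)/4`,
which is `≡ ½` on `[2,∞)`.) [folklore] -/
theorem exists_smooth_ramp :
    ∃ (F : ℝ → ℝ) (B₁ B₂ : ℝ), ContDiff ℝ ∞ F ∧ 1 ≤ B₁ ∧ 1 ≤ B₂ ∧
      (∀ x ≤ 1, F x = 1 - x / 4) ∧
      (∀ x, 0 ≤ x → 1 / 2 ≤ F x ∧ F x ≤ 1) ∧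
      (∀ x < 1, deriv F x = -(1 / 4)) ∧
      (∀ x < 1, deriv (deriv F) x = 0) ∧
      (∀ x, |deriv F x| ≤ B₁) ∧
      (∀ x, |deriv (deriv F) x| ≤ B₂) := by
  set F : ℝ → ℝ := fun x => 1 - x / 4 - (2 - x) * Real.smoothTransition (x - 1) / 4 with hF_def
  have hFs : ContDiff ℝ ∞ F := by
    refine (contDiff_const.sub (contDiff_id.div_const _)).sub
      (((contDiff_const.sub contDiff_id).mul ?_).div_const _)
    exact Real.smoothTransition.contDiff.comp (contDiff_id.sub contDiff_const)
  -- local forms of `F`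
  have hleft : ∀ x < 1, F =ᶠ[𝓝 x] fun y => 1 - y / 4 := by
    intro x hx
    filter_upwards [Iio_mem_nhds hx] with y (hy : y < 1)
    simp only [hF_def, Real.smoothTransition.zero_of_nonpos (by linarith : y - 1 ≤ 0)]
    ring
  have hright : ∀ x > 2, F =ᶠ[𝓝 x] fun _ => (1 / 2 : ℝ) := by
    intro x hx
    filter_upwards [Ioi_mem_nhds hx] with y (hy : 2 < y)
    simp only [hF_def, Real.smoothTransition.one_of_one_le (by linarith : 1 ≤ y - 1)]
    ring
  have hlin : ∀ y : ℝ, HasDerivAt (fun y : ℝ => 1 - y / 4) (-(1 / 4)) y := fun y => by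
    simpa using ((hasDerivAt_id y).div_const 4).const_sub 1
  have hlin' : deriv (fun y : ℝ => 1 - y / 4) = fun _ => -(1 / 4) := funext fun y => (hlin y).deriv
  have hd1 : ∀ x < 1, deriv F x = -(1 / 4) := fun x hx => by
    rw [(hleft x hx).deriv_eq, (hlin x).deriv]
  have hd2 : ∀ x < 1, deriv (deriv F) x = 0 := fun x hx => by
    rw [deriv_deriv_eq_of_eventuallyEq (hleft x hx), hlin', deriv_const]
  have hd1' : ∀ x > 2, deriv F x = 0 := fun x hx => by
    rw [(hright x hx).deriv_eq, deriv_const]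
  have hd2' : ∀ x > 2, deriv (deriv F) x = 0 := fun x hx => by
    rw [deriv_deriv_eq_of_eventuallyEq (hright x hx)]
    simp
  -- global bounds
  have hc1 : Continuous (deriv F) := hFs.continuous_deriv (by simp)
  have hc2 : Continuous (deriv (deriv F)) :=
    ((contDiff_infty_iff_deriv.1 (contDiff_infty_iff_deriv.1 hFs).2).2).continuous
  obtain ⟨B₁, hB₁, hB₁b⟩ := exists_forall_abs_le_of_eqOn hc1 hd1 hd1'
  obtain ⟨B₂, hB₂, hB₂b⟩ := exists_forall_abs_le_of_eqOn hc2 hd2 hd2'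
  refine ⟨F, B₁, B₂, hFs, hB₁, hB₂, fun x hx => ?_, fun x hx => ?_, hd1, hd2, hB₁b, hB₂b⟩
  · simp only [hF_def, Real.smoothTransition.zero_of_nonpos (by linarith : x - 1 ≤ 0)]
    ring
  · have h0 := Real.smoothTransition.nonneg (x - 1)
    have h1 := Real.smoothTransition.le_one (x - 1)
    rcases le_or_gt x 2 with hx2 | hx2
    · simp only [hF_def]
      constructor <;> nlinarith
    · simp only [hF_def, Real.smoothTransition.one_of_one_le (by linarith : 1 ≤ x - 1)]
      constructor <;> linarith

/-- **The smooth bump.** There is a smooth `φ : ℝ → ℝ` with `0 ≤ φ ≤ 1`, `φ(1/4) = 1`, `φ x = 0`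
unless `1/8 < x < 3/8`, `φ' (0) = 0`, and globally bounded first and second derivatives
(a `ContDiffBump` centred at `1/4` with radii `1/16 < 1/8`). [folklore] -/
theorem exists_smooth_bump :
    ∃ (φ : ℝ → ℝ) (Φ₁ Φ₂ : ℝ), ContDiff ℝ ∞ φ ∧ 0 ≤ Φ₁ ∧ 0 ≤ Φ₂ ∧
      (∀ x, 0 ≤ φ x ∧ φ x ≤ 1) ∧ φ (1 / 4) = 1 ∧
      (∀ x, φ x ≠ 0 → 1 / 8 < x ∧ x < 3 / 8) ∧
      φ 0 = 0 ∧ deriv φ 0 = 0 ∧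
      (∀ x, |deriv φ x| ≤ Φ₁) ∧
      (∀ x, |deriv (deriv φ) x| ≤ Φ₂) := by
  let f : ContDiffBump (1 / 4 : ℝ) := ⟨1 / 16, 1 / 8, by norm_num, by norm_num⟩
  have hs : ContDiff ℝ ∞ (f : ℝ → ℝ) := f.contDiff
  have hzero : ∀ x : ℝ, x ≤ 1 / 8 → (f : ℝ → ℝ) x = 0 := fun x hx =>
    f.zero_of_le_dist (by rw [Real.dist_eq, abs_of_nonpos (by linarith)]; norm_num; linarith)
  have hsupp : ∀ x : ℝ, (f : ℝ → ℝ) x ≠ 0 → 1 / 8 < x ∧ x < 3 / 8 := by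
    intro x hx
    have hmem : x ∈ Function.support (f : ℝ → ℝ) := hx
    rw [f.support_eq, Metric.mem_ball, Real.dist_eq, abs_lt] at hmem
    norm_num at hmem
    constructor <;> linarith [hmem.1, hmem.2]
  have h0ev : (f : ℝ → ℝ) =ᶠ[𝓝 0] fun _ => (0 : ℝ) := by
    filter_upwards [Iio_mem_nhds (by norm_num : (0 : ℝ) < 1 / 8)] with y hy
    exact hzero y hy.le
  have hc1 : Continuous (deriv (f : ℝ → ℝ)) := hs.continuous_deriv (by simp)
  have hc2 : Continuous (deriv (deriv (f : ℝ → ℝ))) :=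
    ((contDiff_infty_iff_deriv.1 (contDiff_infty_iff_deriv.1 hs).2).2).continuous
  obtain ⟨Φ₁, hΦ₁⟩ := hc1.bounded_above_of_compact_support f.hasCompactSupport.deriv
  obtain ⟨Φ₂, hΦ₂⟩ := hc2.bounded_above_of_compact_support f.hasCompactSupport.deriv.deriv
  refine ⟨f, max Φ₁ 0, max Φ₂ 0, hs, le_max_right _ _, le_max_right _ _,
    fun x => ⟨f.nonneg, f.le_one⟩, f.one_of_mem_closedBall (Metric.mem_closedBall_self ?_),
    hsupp, hzero 0 (by norm_num), ?_, fun x => ?_, fun x => ?_⟩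
  · show (0 : ℝ) ≤ 1 / 16
    norm_num
  · rw [h0ev.deriv_eq, deriv_const]
  · exact ((Real.norm_eq_abs _).symm.le.trans (hΦ₁ x)).trans (le_max_left _ _)
  · exact ((Real.norm_eq_abs _).symm.le.trans (hΦ₂ x)).trans (le_max_left _ _)

/-- Chain rule for a rescaled argument: `d/ds g(Λs) = g'(Λs) Λ`. [folklore] -/
theorem hasDerivAt_comp_const_mul {g : ℝ → ℝ} (hg : Differentiable ℝ g) (Λ s : ℝ) :
    HasDerivAt (fun s => g (Λ * s)) (deriv g (Λ * s) * Λ) s := by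
  have h1 : HasDerivAt (fun s : ℝ => Λ * s) Λ s := by
    simpa using (hasDerivAt_id s).const_mul Λ
  exact (hg (Λ * s)).hasDerivAt.comp s h1

/-- **Steep energy profiles: the "elementary arguments" of the printed proofs.** There are
absolute constants `A₁, A₂ ≥ 1` such that for every level `c₀ > 0` and every frequency `Λ > 0`
there is a sequence `e : ℕ → ℝ → ℝ` of smooth functions with: `c₀/2 ≤ e n s ≤ c₀` for `s ≥ 0`;
`e n 0 = c₀` and `(e n)'(0) = -c₀Λ/4` (common value and slope at `0`); `|(e n)'| ≤ c₀ΛA₁` and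
`|(e n)''| ≤ c₀Λ²A₂` everywhere; `(e n)' ≤ -c₀Λ/8` on the window `[0, 1/(2Λ)]`; and pairwise
different values at the time `1/(4Λ)` inside the window. (CDLDR's family `𝓔_K` — (i)–(vi) of
the proof of Thm. 1.3 — in the level-`c₀` window, with `K ~ Λ`; see the file header for the
construction and for the corrected window length.)
[cite: ColomboDelellisDerosa2018, §2, proof of Thm. 1.3 (p. 5), properties (i)–(vi)] -/
theorem exists_steepProfileSeq :
    ∃ A₁ A₂ : ℝ, 1 ≤ A₁ ∧ 1 ≤ A₂ ∧
      ∀ c₀ Λ : ℝ, 0 < c₀ → 0 < Λ →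
        ∃ e : ℕ → ℝ → ℝ,
          (∀ n, ContDiff ℝ ∞ (e n)) ∧
          (∀ n s, 0 ≤ s → c₀ / 2 ≤ e n s ∧ e n s ≤ c₀) ∧
          (∀ n, e n 0 = c₀) ∧
          (∀ n, deriv (e n) 0 = -(c₀ * Λ / 4)) ∧
          (∀ n s, |deriv (e n) s| ≤ c₀ * Λ * A₁) ∧
          (∀ n s, |iteratedDeriv 2 (e n) s| ≤ c₀ * Λ ^ 2 * A₂) ∧
          (∀ n, ∀ s ∈ Icc 0 (1 / (2 * Λ)), deriv (e n) s ≤ -(c₀ * Λ / 8)) ∧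
          (∀ m n, m ≠ n → e m (1 / (4 * Λ)) ≠ e n (1 / (4 * Λ))) := by
  obtain ⟨F, B₁, B₂, hFs, hB₁, hB₂, hFlin, hFval, hFd1, hFd2, hFb1, hFb2⟩ := exists_smooth_ramp
  obtain ⟨φ, Φ₁, Φ₂, hφs, hΦ₁, hΦ₂, hφval, hφc, hφsupp, hφ0, hφd0, hφb1, hφb2⟩ := exists_smooth_bump
  refine ⟨B₁ + 1, B₂ + Φ₂ + 1, by linarith, by linarith, fun c₀ Λ hc₀ hΛ => ?_⟩
  -- amplitudes
  set η₀ : ℝ := 1 / (32 + 8 * Φ₁) with hη₀_def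
  have hη₀ : 0 < η₀ := by positivity
  have hη₀' : η₀ ≤ 1 / 32 := by
    rw [hη₀_def]
    exact one_div_le_one_div_of_le (by norm_num) (by linarith)
  have hη₀Φ : η₀ * Φ₁ ≤ 1 / 8 := by
    rw [hη₀_def, div_mul_eq_mul_div, one_mul, div_le_iff₀ (by positivity)]
    linarith
  set η : ℕ → ℝ := fun n => η₀ / (n + 1) with hη_def
  have hηpos : ∀ n, 0 < η n := fun n => by positivity
  have hηle : ∀ n, η n ≤ η₀ := fun n => by
    rw [hη_def]
    exact div_le_self hη₀.le (by norm_cast; omega)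
  have hηinj : ∀ m n, η m = η n → m = n := by
    intro m n h
    simp only [hη_def] at h
    rw [div_eq_div_iff (by positivity) (by positivity)] at h
    have h' : (n : ℝ) + 1 = (m : ℝ) + 1 := by nlinarith [hη₀]
    exact_mod_cast (by linarith : (m : ℝ) = n)
  -- the profiles
  set e : ℕ → ℝ → ℝ := fun n s => c₀ * (F (Λ * s) + η n * φ (Λ * s)) with he_def
  have hFd : Differentiable ℝ F := hFs.differentiable (by simp)
  have hφd : Differentiable ℝ φ := hφs.differentiable (by simp)
  have hFd' : Differentiable ℝ (deriv F) := (contDiff_infty_iff_deriv.1 hFs).2.differentiable (by simp)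
  have hφd' : Differentiable ℝ (deriv φ) := (contDiff_infty_iff_deriv.1 hφs).2.differentiable (by simp)
  -- first derivative
  have hD1 : ∀ n s, HasDerivAt (e n) (c₀ * Λ * (deriv F (Λ * s) + η n * deriv φ (Λ * s))) s := by
    intro n s
    have h := ((hasDerivAt_comp_const_mul hFd Λ s).add
      ((hasDerivAt_comp_const_mul hφd Λ s).const_mul (η n))).const_mul c₀
    simp only [he_def]
    exact h.congr_deriv (by ring)
  have hD1' : ∀ n, deriv (e n) = fun s => c₀ * Λ * (deriv F (Λ * s) + η n * deriv φ (Λ * s)) :=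
    fun n => funext fun s => (hD1 n s).deriv
  have hD1s : ∀ n s, deriv (e n) s = c₀ * Λ * (deriv F (Λ * s) + η n * deriv φ (Λ * s)) :=
    fun n s => (hD1 n s).deriv
  -- second derivative
  have hD2 : ∀ n s, HasDerivAt (deriv (e n))
      (c₀ * Λ ^ 2 * (deriv (deriv F) (Λ * s) + η n * deriv (deriv φ) (Λ * s))) s := by
    intro n s
    rw [hD1' n]
    have h := ((hasDerivAt_comp_const_mul hFd' Λ s).add
      ((hasDerivAt_comp_const_mul hφd' Λ s).const_mul (η n))).const_mul (c₀ * Λ)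
    exact h.congr_deriv (by ring)
  have hD2s : ∀ n s, iteratedDeriv 2 (e n) s =
      c₀ * Λ ^ 2 * (deriv (deriv F) (Λ * s) + η n * deriv (deriv φ) (Λ * s)) := by
    intro n s
    rw [show (2 : ℕ) = 1 + 1 from rfl, iteratedDeriv_succ, iteratedDeriv_one]
    exact (hD2 n s).deriv
  refine ⟨e, fun n => ?_, fun n s hs => ?_, fun n => ?_, fun n => ?_, fun n s => ?_, fun n s => ?_,
    fun n s hs => ?_, fun m n hmn => ?_⟩
  · -- smoothness
    exact contDiff_const.mul ((hFs.comp (contDiff_const.mul contDiff_id)).add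
      (contDiff_const.mul (hφs.comp (contDiff_const.mul contDiff_id))))
  · -- the window of values
    have hx : 0 ≤ Λ * s := by positivity
    obtain ⟨hF1, hF2⟩ := hFval _ hx
    obtain ⟨hφ1, hφ2⟩ := hφval (Λ * s)
    have hηφ : 0 ≤ η n * φ (Λ * s) := mul_nonneg (hηpos n).le hφ1
    constructor
    · simp only [he_def]
      nlinarith
    · simp only [he_def]
      by_cases hφz : φ (Λ * s) = 0
      · rw [hφz, mul_zero, add_zero]
        nlinarith
      · obtain ⟨h18, h38⟩ := hφsupp _ hφz
        rw [hFlin _ (by linarith)]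
        have : η n * φ (Λ * s) ≤ 1 / 32 := by
          calc η n * φ (Λ * s) ≤ η₀ * 1 := mul_le_mul (hηle n) hφ2 hφ1 hη₀.le
            _ ≤ 1 / 32 := by linarith
        nlinarith
  · -- value at `0`
    simp only [he_def, mul_zero, hφ0, hFlin 0 (by norm_num)]
    ring
  · -- slope at `0`
    rw [hD1s n 0]
    simp only [mul_zero, hφd0, hFd1 0 (by norm_num)]
    ring
  · -- global slope bound
    rw [hD1s n s]
    have h1 := hFb1 (Λ * s)
    have h2 := hφb1 (Λ * s)
    have h3 : |η n * deriv φ (Λ * s)| ≤ 1 / 8 := by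
      rw [abs_mul, abs_of_pos (hηpos n)]
      calc η n * |deriv φ (Λ * s)| ≤ η₀ * Φ₁ := mul_le_mul (hηle n) h2 (abs_nonneg _) hη₀.le
        _ ≤ 1 / 8 := hη₀Φ
    have h4 : |deriv F (Λ * s) + η n * deriv φ (Λ * s)| ≤ B₁ + 1 :=
      (abs_add_le _ _).trans (by linarith)
    simp only [abs_mul, abs_of_pos hc₀, abs_of_pos hΛ]
    exact mul_le_mul_of_nonneg_left h4 (by positivity)
  · -- global curvature bound
    rw [hD2s n s]
    have h1 := hFb2 (Λ * s)
    have h2 := hφb2 (Λ * s)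
    have h3 : |η n * deriv (deriv φ) (Λ * s)| ≤ Φ₂ := by
      rw [abs_mul, abs_of_pos (hηpos n)]
      calc η n * |deriv (deriv φ) (Λ * s)| ≤ 1 * Φ₂ :=
            mul_le_mul ((hηle n).trans (by linarith)) h2 (abs_nonneg _) zero_le_one
        _ = Φ₂ := one_mul _
    have h4 : |deriv (deriv F) (Λ * s) + η n * deriv (deriv φ) (Λ * s)| ≤ B₂ + Φ₂ + 1 :=
      (abs_add_le _ _).trans (by linarith)
    simp only [abs_mul, abs_of_pos hc₀, abs_pow, abs_of_pos hΛ]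
    exact mul_le_mul_of_nonneg_left h4 (by positivity)
  · -- steep decay on the window
    rw [hD1s n s]
    obtain ⟨hs0, hs1⟩ := hs
    have hx1 : Λ * s < 1 := by
      calc Λ * s ≤ Λ * (1 / (2 * Λ)) := mul_le_mul_of_nonneg_left hs1 hΛ.le
        _ = 1 / 2 := by field_simp
        _ < 1 := by norm_num
    rw [hFd1 _ hx1]
    have h2 : η n * deriv φ (Λ * s) ≤ 1 / 8 := by
      calc η n * deriv φ (Λ * s) ≤ η n * |deriv φ (Λ * s)| :=
            mul_le_mul_of_nonneg_left (le_abs_self _) (hηpos n).le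
        _ ≤ η₀ * Φ₁ := mul_le_mul (hηle n) (hφb1 _) (abs_nonneg _) hη₀.le
        _ ≤ 1 / 8 := hη₀Φ
    have hpos : 0 < c₀ * Λ := mul_pos hc₀ hΛ
    nlinarith
  · -- distinct values at `1/(4Λ)`
    intro h
    have hx : Λ * (1 / (4 * Λ)) = 1 / 4 := by field_simp
    simp only [he_def, hx, hφc, mul_one] at h
    have h' : η m = η n := by
      have := mul_left_cancel₀ hc₀.ne' h
      linarith
    exact hmn (hηinj m n h')

/-- **The mean-value step.** If `f` is differentiable and `f' ≤ -R` on `[a, b]`, then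
`f t + R (t - s) ≤ f s` for `a ≤ s ≤ t ≤ b` (printed: "by (iv) … `½(e(s) - e(t)) ≥ (K-1)(t-s)`").
[folklore] -/
theorem sub_le_of_deriv_le_on_Icc {f : ℝ → ℝ} (hf : Differentiable ℝ f) {a b R : ℝ}
    (h : ∀ x ∈ Icc a b, deriv f x ≤ -R) {s t : ℝ} (has : a ≤ s) (hst : s ≤ t) (htb : t ≤ b) :
    f t + R * (t - s) ≤ f s := by
  have key := Convex.image_sub_le_mul_sub_of_deriv_le (convex_Icc a b) hf.continuous.continuousOn
    (hf.differentiableOn.mono interior_subset)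
    (fun x hx => h x (interior_subset hx)) s ⟨has, hst.trans htb⟩ t ⟨has.trans hst, htb⟩ hst
  linarith

end Calculus

end Literature.Analysis.FluidPDE
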